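import Summits.QuantumFields.BalabanUV.Beta.SpineRootedT2
import Summits.QuantumFields.BalabanUV.Beta.AxialDressingRootedBmHessian
import Summits.QuantumFields.BalabanUV.Beta.AxialCoordinateProjectorBm

/-!
# PREPARATORY (pending β-lead RULING (R42-1); touches NO wall object): the BLOCK-MEAN-dressed rooted spine
# `JsBalBmAtOf := dressBmAt ρ ∘ JsBal0AtOf` (defined BESIDE `JsBalAtOf`, replacing nothing), its instantiated / plugged members
# `JsBalW2BmAtOf`, `JsBalT2BmAtOf`, `JsBalBmAn1At`, `JsBalBmAn1AtCtr`, their (St♭)/(Wt) sockets, and the `hR` wiring at the centred root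

HONEST FRAMING (cell charter, verbatim): «discharging BetaPertH makes Balaban's UV stability UNCONDITIONAL — a real
constructive-QFT result; it is NOT the continuum limit and NOT the Clay problem.»  DERIVED cell leaf (β sub-cell, lane an2 gen 12,
NOTE X-an2-42 repair (A), file 7); no statement of Bałaban's papers, no `[cite:]` tag, no `Prop` fact; instantiates no wall binder.
These are CANDIDATE OBJECTS for the lead's ruling (R42-1) (a would-be v2.23 literal `D1Drift Lc (SpineRooted.JsBalBmAn1At hLc hr …) N μ ν`);
the wall literal itself is the lead's to write and is NOT changed here.  NOT `BetaPertH`; NOT continuum; NOT Clay.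

## What is here (decl-by-decl twins of `SpineRootedStep` §C3–§C4, `SpineRootedW2` §D2–§D3, `SpineRootedT2` §E2–§E3 and
## `SpineRootedReflectionWiring` with `dressAt ↦ dressBmAt`)
* `JsBalBmAtOf hLc hr … := fun j ↦ dressBmAt hr (JsBal0AtOf hLc hr … j)` (the UNDRESSED rooted spine is an1/an2's `JsBal0AtOf`, unchanged),
  `JsBalBmAtOf_apply`, `JsBalBmAtOf_S_translate`, `JsBalBmAtOf_W_translate`;
* `JsBalW2BmAtOf`, `JsBalW2BmAtOf_apply/_S_translate/_W_translate`; `JsBalT2BmAtOf`, `JsBalT2BmAtOf_eq/_S_translate/_W_translate`;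
* `JsBalBmAn1At hLc hr cE cVH cΛ cE₂ cB T` (an1's rooted border tables plugged at the same root), `JsBalBmAn1At_eq/_S_translate/_W_translate`,
  the centred `JsBalBmAn1AtCtr` (`d = 3`), `JsBalBmAn1AtCtr_eq`;
* **`axisReflectionCovariant_flipK_TbalOf_JsBalBmAtOf_ctr`**: `hR` for the centred block-mean-dressed spine from EXACTLY rules 3–4 of
  `RelInv G_j (𝕄 j) (axE ctr Lc)` for a binder `𝕄 j` (`G_j := coDressKBmAt ctr Lc (KInvStep Lc j)`; rules 1–2 PROVED,
  `axE_rules_coDressKBmAt_KInvStep`), the undressed (Sr-conj)/(Wr-conj) against `𝕄 j` and `E`-commuting contacts.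
All declarations `[folklore]`; axioms standard.  Provenance: b2b-balaban β sub-cell, unit beta-an2 gen 12, 2026-08-20.
-/

open Finset
open scoped BigOperators
open Literature.MathematicalPhysics.QuantumFieldTheory
open Literature.MathematicalPhysics.QuantumFieldTheory.Balaban1983to89
open Literature.MathematicalPhysics.QuantumFieldTheory.Balaban1983to89.Beta
open B12Sec2to5 (l1 l1_nonneg)
open ExpKernelCalculus (MKer Decays BiLoc comp tr VertexFamily VertexFamily₂ shiftK)
open AffineAveraging (Form1 Form2 box toSite)
open AveragingContoursRooted (ctrOff ctrOff_mem_box)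
open PolarizationSign (reflSign AxisReflectionCovariant)
open KernelReflection (refK)
open ResolventReflection (bref Φ)
open OneStepResolventKernel (Fib LocStencil JetData)
open OneStepKernelFamily (KInvStep vertexOfK TbalOf flipK)
open BalabanCompositeJets (LocStencil₂)
open SecondOrderResponse (LocStencilFM)
open Summit.QuantumFields.BalabanUV.Beta.TameKernelCalculus
open Summit.QuantumFields.BalabanUV.Beta.ChartConjugation (conjV conjW)
open Summit.QuantumFields.BalabanUV.Beta.ChartConjugationRelative (RelInv)
open Summit.QuantumFields.BalabanUV.Beta.AxialDressingRooted (dressBmAt dressBmAt_S dressBmAt_W dressBmAtS_translate dressBmAtW_translate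
  coDressKBmAt axE spr_axE axE_rules_coDressKBmAt_KInvStep axisReflectionCovariant_flipK_TbalOf_dressBmCtr_rel one_le_of_neZero)
open Summit.QuantumFields.BalabanUV.Beta.MixedJetTablesPlug (hB_an1 hmix_an1 hBt_an1 hmixt_an1)

namespace Summit.QuantumFields.BalabanUV.Beta.SpineRooted

noncomputable section

variable {d : ℕ}

/-! ## §1 The block-mean-dressed rooted family `JsBalBm_ρ := dressBmAt ρ ∘ JsBal⁰_ρ` and its sockets -/

section FamilyBm

variable {Lc : ℕ} [NeZero Lc] (hLc : 1 ≤ Lc) {r : Fin (d + 1) → ℕ} (hr : r ∈ box (d + 1) Lc) (cE cVH cΛ : ℝ)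
    (W : ℕ → Fin (d + 1) → (Fin (d + 1) → ℤ) → Fin (d + 1) → (Fin (d + 1) → ℤ) → ExpKernelCalculus.MKer (d + 1) (Fib d))
    (Cw δw : ℕ → ℝ) (hδw : ∀ j, 0 < δw j) (hW : ∀ j, VertexFamily₂ (W j) Lc (Cw j) (δw j))

/-- [folklore] **THE BLOCK-MEAN-DRESSED ROOTED FAMILY `JsBalBm_ρ := dressBmAt ρ ∘ JsBal⁰_ρ`** — ONE root `ρ = toSite r` for the averaging
tables AND for the block-mean-normalised axial dressing (an2's `AxialDressingRooted.dressBmAt hr`). -/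
def JsBalBmAtOf : ℕ → JetData d Lc := fun j => dressBmAt hr (JsBal0AtOf hLc hr cE cVH cΛ W Cw δw hδw hW j)

/-- [folklore] `JsBalBm_ρ` is `dressBmAt ρ ∘ JsBal⁰_ρ`, by definition. -/
theorem JsBalBmAtOf_apply (j : ℕ) :
    JsBalBmAtOf hLc hr cE cVH cΛ W Cw δw hδw hW j = dressBmAt hr (JsBal0AtOf hLc hr cE cVH cΛ W Cw δw hδw hW j) := rfl

/-- [folklore] **(St♭) FOR `JsBalBm_ρ`**, every member — an2's `AxialDressingRooted.dressBmAtS_translate`. -/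
theorem JsBalBmAtOf_S_translate (j : ℕ) (κ' : Fin (d + 1)) (u t : Fin (d + 1) → ℤ) :
    (JsBalBmAtOf hLc hr cE cVH cΛ W Cw δw hδw hW j).S κ' (u + (Lc : ℤ) • t)
      = shiftK (-((Lc : ℤ) • t)) ((JsBalBmAtOf hLc hr cE cVH cΛ W Cw δw hδw hW j).S κ' u) := by
  show (dressBmAt hr (JsBal0AtOf hLc hr cE cVH cΛ W Cw δw hδw hW j)).S κ' (u + (Lc : ℤ) • t)
    = shiftK (-((Lc : ℤ) • t)) ((dressBmAt hr (JsBal0AtOf hLc hr cE cVH cΛ W Cw δw hδw hW j)).S κ' u)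
  rw [dressBmAt_S, dressBmAt_S]
  exact dressBmAtS_translate (toSite r) hLc (JsBal0AtOf_S_translate hLc hr cE cVH cΛ W Cw δw hδw hW j) κ' u t

/-- [folklore] **(Wt) FOR `JsBalBm_ρ` FROM (Wt) OF THE TABLES** — an2's `AxialDressingRooted.dressBmAtW_translate`. -/
theorem JsBalBmAtOf_W_translate
    (hWt : ∀ (j : ℕ) (μ : Fin (d + 1)) (y : Fin (d + 1) → ℤ) (ν : Fin (d + 1)) (y' t : Fin (d + 1) → ℤ),
      W j μ (y + t) ν (y' + t) = shiftK (-((Lc : ℤ) • t)) (W j μ y ν y'))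
    (j : ℕ) (μ : Fin (d + 1)) (y : Fin (d + 1) → ℤ) (ν : Fin (d + 1)) (y' t : Fin (d + 1) → ℤ) :
    (JsBalBmAtOf hLc hr cE cVH cΛ W Cw δw hδw hW j).W μ (y + t) ν (y' + t)
      = shiftK (-((Lc : ℤ) • t)) ((JsBalBmAtOf hLc hr cE cVH cΛ W Cw δw hδw hW j).W μ y ν y') := by
  show (dressBmAt hr (JsBal0AtOf hLc hr cE cVH cΛ W Cw δw hδw hW j)).W μ (y + t) ν (y' + t)
    = shiftK (-((Lc : ℤ) • t)) ((dressBmAt hr (JsBal0AtOf hLc hr cE cVH cΛ W Cw δw hδw hW j)).W μ y ν y')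
  rw [dressBmAt_W, dressBmAt_W, JsBal0AtOf_W]
  exact dressBmAtW_translate (toSite r) hLc (hWt j) μ y ν y' t

end FamilyBm

/-! ## §2 The instantiated block-mean-dressed families `JsBalW2BmAtOf`, `JsBalT2BmAtOf` -/

section InstBm

variable {Lc : ℕ} [NeZero Lc] (hLc : 1 ≤ Lc) {r : Fin (d + 1) → ℕ} (hr : r ∈ box (d + 1) Lc) (cE cVH cΛ : ℝ)
    {T₂ : ℕ → Fin (d + 1) → (Fin (d + 1) → ℤ) → Fin (d + 1) → (Fin (d + 1) → ℤ) → ExpKernelCalculus.MKer (d + 1) (Fib d)}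
    {mixFF : Fin (d + 1) → (Fin (d + 1) → ℤ) → Fin (d + 1) → (Fin (d + 1) → ℤ) → ExpKernelCalculus.MKer (d + 1) (Fib d)}
    (hT₂ : ∀ j, ∃ C δ : ℝ, 0 < δ ∧ LocStencil₂ (T₂ j) C δ) (hmix : ∃ C δ : ℝ, 0 < δ ∧ LocStencilFM Lc mixFF C δ)

/-- [folklore] **THE BLOCK-MEAN-DRESSED ROOTED FAMILY WITH ITS SECOND-ORDER TABLES** (twin of `JsBalW2AtOf`). -/
def JsBalW2BmAtOf : ℕ → JetData d Lc :=
  JsBalBmAtOf hLc hr cE cVH cΛ (WbalAtOf d Lc (toSite r) cE cVH cΛ T₂ mixFF) (CwAtOf hLc hr cE cVH cΛ hT₂ hmix)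
    (δwAtOf hLc hr cE cVH cΛ hT₂ hmix) (δwAtOf_pos hLc hr cE cVH cΛ hT₂ hmix) (WbalAtOf_loc₂ hLc hr cE cVH cΛ hT₂ hmix)

/-- [folklore] `JsBalW2BmAtOf` member by member: the block-mean dressing of the rooted undressed member, by `rfl`. -/
theorem JsBalW2BmAtOf_apply (j : ℕ) :
    JsBalW2BmAtOf hLc hr cE cVH cΛ hT₂ hmix j
      = dressBmAt hr (JsBal0AtOf hLc hr cE cVH cΛ (WbalAtOf d Lc (toSite r) cE cVH cΛ T₂ mixFF) (CwAtOf hLc hr cE cVH cΛ hT₂ hmix)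
          (δwAtOf hLc hr cE cVH cΛ hT₂ hmix) (δwAtOf_pos hLc hr cE cVH cΛ hT₂ hmix) (WbalAtOf_loc₂ hLc hr cE cVH cΛ hT₂ hmix) j) :=
  rfl

/-- [folklore] (St♭) for `JsBalW2BmAtOf`. -/
theorem JsBalW2BmAtOf_S_translate (j : ℕ) (κ' : Fin (d + 1)) (u t : Fin (d + 1) → ℤ) :
    (JsBalW2BmAtOf hLc hr cE cVH cΛ hT₂ hmix j).S κ' (u + (Lc : ℤ) • t)
      = shiftK (-((Lc : ℤ) • t)) ((JsBalW2BmAtOf hLc hr cE cVH cΛ hT₂ hmix j).S κ' u) :=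
  JsBalBmAtOf_S_translate hLc hr cE cVH cΛ _ _ _ _ _ j κ' u t

/-- [folklore] (Wt) for `JsBalW2BmAtOf` from the joint covariance of the two binder tables. -/
theorem JsBalW2BmAtOf_W_translate
    (hT₂t : ∀ (j : ℕ) (κ : Fin (d + 1)) (u : Fin (d + 1) → ℤ) (κ' : Fin (d + 1)) (u' t : Fin (d + 1) → ℤ),
      T₂ j κ (u + (Lc : ℤ) • t) κ' (u' + (Lc : ℤ) • t) = shiftK (-((Lc : ℤ) • t)) (T₂ j κ u κ' u'))
    (hmixt : ∀ (κ : Fin (d + 1)) (u : Fin (d + 1) → ℤ) (μ : Fin (d + 1)) (w t : Fin (d + 1) → ℤ),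
      mixFF κ (u + (Lc : ℤ) • t) μ (w + t) = shiftK (-((Lc : ℤ) • t)) (mixFF κ u μ w))
    (j : ℕ) (μ : Fin (d + 1)) (y : Fin (d + 1) → ℤ) (ν : Fin (d + 1)) (y' t : Fin (d + 1) → ℤ) :
    (JsBalW2BmAtOf hLc hr cE cVH cΛ hT₂ hmix j).W μ (y + t) ν (y' + t)
      = shiftK (-((Lc : ℤ) • t)) ((JsBalW2BmAtOf hLc hr cE cVH cΛ hT₂ hmix j).W μ y ν y') :=
  JsBalBmAtOf_W_translate hLc hr cE cVH cΛ _ _ _ _ _ (WbalAtOf_translate (toSite r) hLc cE cVH cΛ hT₂t hmixt) j μ y ν y' t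

end InstBm

section T2Bm

variable {Lc : ℕ} [NeZero Lc] (hLc : 1 ≤ Lc) {r : Fin (d + 1) → ℕ} (hr : r ∈ box (d + 1) Lc) (cE cVH cΛ cE₂ cB : ℝ)
    (T : Fin 4 → Fin 4 → Fin 4 → Fin 4 → ℝ)
    {vh₂S : Fin (d + 1) → (Fin (d + 1) → ℤ) → Fin (d + 1) → (Fin (d + 1) → ℤ) → ExpKernelCalculus.MKer (d + 1) (Fib d)}
    (hB : ∃ C δ : ℝ, 0 < δ ∧ LocStencil₂ vh₂S C δ)
    {mixFF : Fin (d + 1) → (Fin (d + 1) → ℤ) → Fin (d + 1) → (Fin (d + 1) → ℤ) → ExpKernelCalculus.MKer (d + 1) (Fib d)}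
    (hmix : ∃ C δ : ℝ, 0 < δ ∧ LocStencilFM Lc mixFF C δ)

/-- [folklore] **THE BLOCK-MEAN-DRESSED ROOTED FAMILY WITH RECURSIVE SECOND-ORDER TABLES** (twin of `JsBalT2AtOf`). -/
def JsBalT2BmAtOf : ℕ → JetData d Lc :=
  JsBalW2BmAtOf hLc hr cE cVH cΛ (T2AtOf_loc hLc hr cE cVH cΛ cE₂ cB T hB hmix) hmix

/-- [folklore] `JsBalT2BmAtOf` unfolds to `JsBalW2BmAtOf` at the recursive tables (closure lemma). -/
theorem JsBalT2BmAtOf_eq :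
    JsBalT2BmAtOf hLc hr cE cVH cΛ cE₂ cB T hB hmix
      = JsBalW2BmAtOf hLc hr cE cVH cΛ (T2AtOf_loc hLc hr cE cVH cΛ cE₂ cB T hB hmix) hmix := rfl

/-- [folklore] (Wt) for `JsBalT2BmAtOf` — only the two border covariance hypotheses remain. -/
theorem JsBalT2BmAtOf_W_translate
    (hBt : ∀ (κ : Fin (d + 1)) (u : Fin (d + 1) → ℤ) (κ' : Fin (d + 1)) (u' t : Fin (d + 1) → ℤ),
      vh₂S κ (u + (Lc : ℤ) • t) κ' (u' + (Lc : ℤ) • t) = shiftK (-((Lc : ℤ) • t)) (vh₂S κ u κ' u'))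
    (hmixt : ∀ (κ : Fin (d + 1)) (u : Fin (d + 1) → ℤ) (μ : Fin (d + 1)) (w t : Fin (d + 1) → ℤ),
      mixFF κ (u + (Lc : ℤ) • t) μ (w + t) = shiftK (-((Lc : ℤ) • t)) (mixFF κ u μ w))
    (j : ℕ) (μ : Fin (d + 1)) (y : Fin (d + 1) → ℤ) (ν : Fin (d + 1)) (y' t : Fin (d + 1) → ℤ) :
    (JsBalT2BmAtOf hLc hr cE cVH cΛ cE₂ cB T hB hmix j).W μ (y + t) ν (y' + t)
      = shiftK (-((Lc : ℤ) • t)) ((JsBalT2BmAtOf hLc hr cE cVH cΛ cE₂ cB T hB hmix j).W μ y ν y') :=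
  JsBalW2BmAtOf_W_translate hLc hr cE cVH cΛ _ hmix (T2AtOf_translate (toSite r) hLc cE cVH cΛ cE₂ cB T hBt hmixt) hmixt j μ y ν y' t

/-- [folklore] (St♭) for `JsBalT2BmAtOf`. -/
theorem JsBalT2BmAtOf_S_translate (j : ℕ) (κ' : Fin (d + 1)) (u t : Fin (d + 1) → ℤ) :
    (JsBalT2BmAtOf hLc hr cE cVH cΛ cE₂ cB T hB hmix j).S κ' (u + (Lc : ℤ) • t)
      = shiftK (-((Lc : ℤ) • t)) ((JsBalT2BmAtOf hLc hr cE cVH cΛ cE₂ cB T hB hmix j).S κ' u) :=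
  JsBalW2BmAtOf_S_translate hLc hr cE cVH cΛ _ hmix j κ' u t

end T2Bm

/-! ## §3 an1's rooted border tables plugged at the same root: `JsBalBmAn1At`, `JsBalBmAn1AtCtr` -/

section PlugBm

variable {Lc : ℕ} [NeZero Lc] {r : Fin (d + 1) → ℕ}

/-- **THE COHERENT BLOCK-MEAN-DRESSED ROOTED FAMILY** (twin of `JsBalAn1At`): recursive second-order tables, an1's rooted border tables
`vh₂SAt (toSite r) Lc` / `mixFFAt (toSite r) Lc` plugged through `hB_an1 hLc hr` / `hmix_an1 hLc hr`; binders `hLc`, `hr`, the colour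
constants, an3's position table `T`.  CANDIDATE object for ruling (R42-1); not a wall literal. -/
def JsBalBmAn1At (hLc : 1 ≤ Lc) (hr : r ∈ box (d + 1) Lc) (cE cVH cΛ cE₂ cB : ℝ) (T : Fin 4 → Fin 4 → Fin 4 → Fin 4 → ℝ) :
    ℕ → JetData d Lc :=
  JsBalT2BmAtOf hLc hr cE cVH cΛ cE₂ cB T (hB_an1 hLc hr) (hmix_an1 hLc hr)

/-- `JsBalBmAn1At` is `JsBalT2BmAtOf` at an1's rooted tables, by `rfl`. -/
theorem JsBalBmAn1At_eq (hLc : 1 ≤ Lc) (hr : r ∈ box (d + 1) Lc) (cE cVH cΛ cE₂ cB : ℝ) (T : Fin 4 → Fin 4 → Fin 4 → Fin 4 → ℝ) :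
    JsBalBmAn1At hLc hr cE cVH cΛ cE₂ cB T = JsBalT2BmAtOf hLc hr cE cVH cΛ cE₂ cB T (hB_an1 hLc hr) (hmix_an1 hLc hr) := rfl

/-- (Wt) for the coherent block-mean-dressed rooted family — border covariance hypotheses discharged by an1's rooted laws. -/
theorem JsBalBmAn1At_W_translate (hLc : 1 ≤ Lc) (hr : r ∈ box (d + 1) Lc) (cE cVH cΛ cE₂ cB : ℝ)
    (T : Fin 4 → Fin 4 → Fin 4 → Fin 4 → ℝ) (j : ℕ) (μ : Fin (d + 1)) (y : Fin (d + 1) → ℤ) (ν : Fin (d + 1))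
    (y' t : Fin (d + 1) → ℤ) :
    (JsBalBmAn1At hLc hr cE cVH cΛ cE₂ cB T j).W μ (y + t) ν (y' + t)
      = shiftK (-((Lc : ℤ) • t)) ((JsBalBmAn1At hLc hr cE cVH cΛ cE₂ cB T j).W μ y ν y') :=
  JsBalT2BmAtOf_W_translate hLc hr cE cVH cΛ cE₂ cB T (hB_an1 hLc hr) (hmix_an1 hLc hr)
    (hBt_an1 hLc (toSite r)) (hmixt_an1 (toSite r)) j μ y ν y' t

/-- (St♭) for the coherent block-mean-dressed rooted family. -/
theorem JsBalBmAn1At_S_translate (hLc : 1 ≤ Lc) (hr : r ∈ box (d + 1) Lc) (cE cVH cΛ cE₂ cB : ℝ)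
    (T : Fin 4 → Fin 4 → Fin 4 → Fin 4 → ℝ) (j : ℕ) (κ' : Fin (d + 1)) (u t : Fin (d + 1) → ℤ) :
    (JsBalBmAn1At hLc hr cE cVH cΛ cE₂ cB T j).S κ' (u + (Lc : ℤ) • t)
      = shiftK (-((Lc : ℤ) • t)) ((JsBalBmAn1At hLc hr cE cVH cΛ cE₂ cB T j).S κ' u) :=
  JsBalT2BmAtOf_S_translate hLc hr cE cVH cΛ cE₂ cB T (hB_an1 hLc hr) (hmix_an1 hLc hr) j κ' u t

/-- **THE CENTRED COHERENT BLOCK-MEAN-DRESSED FAMILY** at `d = 3` (twin of `JsBalAn1AtCtr`): the root is the block centre `ctrOff 4 Lc`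
(odd `Lc` downstream).  CANDIDATE object for ruling (R42-1); not a wall literal. -/
def JsBalBmAn1AtCtr {Lc : ℕ} [NeZero Lc] (hLc : 1 ≤ Lc) (cE cVH cΛ cE₂ cB : ℝ) (T : Fin 4 → Fin 4 → Fin 4 → Fin 4 → ℝ) :
    ℕ → JetData 3 Lc :=
  JsBalBmAn1At (d := 3) hLc (ctrOff_mem_box hLc) cE cVH cΛ cE₂ cB T

/-- `JsBalBmAn1AtCtr` is `JsBalBmAn1At` at the centred root, by `rfl`. -/
theorem JsBalBmAn1AtCtr_eq {Lc : ℕ} [NeZero Lc] (hLc : 1 ≤ Lc) (cE cVH cΛ cE₂ cB : ℝ) (T : Fin 4 → Fin 4 → Fin 4 → Fin 4 → ℝ) :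
    JsBalBmAn1AtCtr hLc cE cVH cΛ cE₂ cB T = JsBalBmAn1At (d := 3) hLc (ctrOff_mem_box hLc) cE cVH cΛ cE₂ cB T := rfl

end PlugBm

/-! ## §4 `hR` for the centred block-mean-dressed spine from rules 3–4 and the undressed conjugated jet laws only -/

section WiringBm

/-- [folklore] **`hR` FOR THE CENTRED BLOCK-MEAN-DRESSED SPINE FROM RULES 3–4 AND THE UNDRESSED CONJUGATED JET LAWS ONLY** (twin of
`axisReflectionCovariant_flipK_TbalOf_JsBalAtOf_ctr`; rules 1–2 of `RelInv G_j (𝕄 j) (axE ctr Lc)` discharged inside by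
`axE_rules_coDressKBmAt_KInvStep`, reflection invariance of `G_j := coDressKBmAt ctr Lc (KInvStep Lc j)` by `refK_coDressKBmAt_KInvStep`).
Discharges nothing of the wall by itself. -/
theorem axisReflectionCovariant_flipK_TbalOf_JsBalBmAtOf_ctr {Lc : ℕ} [NeZero Lc] (hLc : Odd Lc) (cE cVH cΛ : ℝ)
    (W : ℕ → Fin 4 → (Fin 4 → ℤ) → Fin 4 → (Fin 4 → ℤ) → MKer 4 (Fib 3)) (Cw δw : ℕ → ℝ) (hδw : ∀ j, 0 < δw j)
    (hW : ∀ j, VertexFamily₂ (W j) Lc (Cw j) (δw j))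
    (hWt : ∀ (j : ℕ) (μ : Fin 4) (y : Fin 4 → ℤ) (ν : Fin 4) (y' t : Fin 4 → ℤ),
      W j μ (y + t) ν (y' + t) = shiftK (-((Lc : ℤ) • t)) (W j μ y ν y'))
    (M : ℕ → MKer 4 (Fib 3)) (hM : ∀ j, Spr (M j))
    (h3 : ∀ j, comp (comp (coDressKBmAt (toSite (ctrOff 4 Lc)) Lc (KInvStep (d := 3) Lc j)) (M j)) (axE (toSite (ctrOff 4 Lc)) Lc) =
      axE (toSite (ctrOff 4 Lc)) Lc)
    (h4 : ∀ j, comp (comp (axE (toSite (ctrOff 4 Lc)) Lc) (M j)) (coDressKBmAt (toSite (ctrOff 4 Lc)) Lc (KInvStep (d := 3) Lc j)) =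
      axE (toSite (ctrOff 4 Lc)) Lc)
    (C : ℕ → Fin 4 → Fin 4 → (Fin 4 → ℤ) → MKer 4 (Fib 3)) (Cc δc : ℕ → ℝ) (hC : ∀ j α, LocStencil (C j α) (Cc j) (δc j))
    (hδc : ∀ j, 0 < δc j) (X₂ : ℕ → Fin 4 → Fin 4 → (Fin 4 → ℤ) → Fin 4 → (Fin 4 → ℤ) → MKer 4 (Fib 3))
    (hX₂ : ∀ j α μ y ν y', Loc (X₂ j α μ y ν y'))
    (hEC : ∀ j α κ' u, comp (axE (toSite (ctrOff 4 Lc)) Lc) (C j α κ' u) = comp (C j α κ' u) (axE (toSite (ctrOff 4 Lc)) Lc))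
    (hEX₂ : ∀ j α μ y ν y', comp (axE (toSite (ctrOff 4 Lc)) Lc) (X₂ j α μ y ν y') = comp (X₂ j α μ y ν y') (axE (toSite (ctrOff 4 Lc)) Lc))
    (hSrC : ∀ (j : ℕ) (α κ' : Fin 4) (u : Fin 4 → ℤ),
      (JsBal0AtOf (d := 3) hLc.pos (ctrOff_mem_box hLc.pos) cE cVH cΛ W Cw δw hδw hW j).S κ' (bref α κ' u) =
        reflSign α κ' • refK (Φ Lc α)
          ((JsBal0AtOf (d := 3) hLc.pos (ctrOff_mem_box hLc.pos) cE cVH cΛ W Cw δw hδw hW j).S κ' u + conjV (M j) (C j α κ' u)))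
    (hWrC : ∀ (j : ℕ) (α μ : Fin 4) (y : Fin 4 → ℤ) (ν : Fin 4) (y' : Fin 4 → ℤ),
      (JsBal0AtOf (d := 3) hLc.pos (ctrOff_mem_box hLc.pos) cE cVH cΛ W Cw δw hδw hW j).W μ (bref α μ y) ν (bref α ν y') =
        (reflSign α μ * reflSign α ν) • refK (Φ Lc α)
          ((JsBal0AtOf (d := 3) hLc.pos (ctrOff_mem_box hLc.pos) cE cVH cΛ W Cw δw hδw hW j).W μ y ν y' +
            conjW (M j)
              (vertexOfK (coDressKBmAt (toSite (ctrOff 4 Lc)) Lc (KInvStep (d := 3) Lc j)) Lc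
                (JsBal0AtOf (d := 3) hLc.pos (ctrOff_mem_box hLc.pos) cE cVH cΛ W Cw δw hδw hW j).S μ y)
              (vertexOfK (coDressKBmAt (toSite (ctrOff 4 Lc)) Lc (KInvStep (d := 3) Lc j)) Lc
                (JsBal0AtOf (d := 3) hLc.pos (ctrOff_mem_box hLc.pos) cE cVH cΛ W Cw δw hδw hW j).S ν y')
              (vertexOfK (coDressKBmAt (toSite (ctrOff 4 Lc)) Lc (KInvStep (d := 3) Lc j)) Lc (C j α) μ y)
              (vertexOfK (coDressKBmAt (toSite (ctrOff 4 Lc)) Lc (KInvStep (d := 3) Lc j)) Lc (C j α) ν y') (X₂ j α μ y ν y'))) :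
    ∀ j : ℕ, AxisReflectionCovariant
      (flipK (TbalOf Lc (JsBalBmAtOf (d := 3) hLc.pos (ctrOff_mem_box hLc.pos) cE cVH cΛ W Cw δw hδw hW) j)) := by
  have hR : ∀ j, RelInv (coDressKBmAt (toSite (ctrOff 4 Lc)) Lc (KInvStep (d := 3) Lc j)) (M j) (axE (toSite (ctrOff 4 Lc)) Lc) :=
    fun j => ⟨(axE_rules_coDressKBmAt_KInvStep (ctrOff_mem_box (one_le_of_neZero Lc)) j).1,
      (axE_rules_coDressKBmAt_KInvStep (ctrOff_mem_box (one_le_of_neZero Lc)) j).2, h3 j, h4 j⟩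
  exact axisReflectionCovariant_flipK_TbalOf_dressBmCtr_rel hLc
    (JsBal0AtOf (d := 3) hLc.pos (ctrOff_mem_box hLc.pos) cE cVH cΛ W Cw δw hδw hW) M (axE (toSite (ctrOff 4 Lc)) Lc) hM
    (spr_axE _ _) hR (JsBal0AtOf_S_translate hLc.pos (ctrOff_mem_box hLc.pos) cE cVH cΛ W Cw δw hδw hW)
    (JsBal0AtOf_W_translate hLc.pos (ctrOff_mem_box hLc.pos) cE cVH cΛ W Cw δw hδw hW hWt) C Cc δc hC hδc X₂ hX₂ hEC hEX₂ hSrC hWrC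

end WiringBm

end

end Summit.QuantumFields.BalabanUV.Beta.SpineRooted
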